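import Literature.MathematicalPhysics.QuantumFieldTheory.Balaban1983to89.B14FlowStep

/-!
# T4ScalePairing — node U5c / NE7b (cell `pub-balaban`, T4-DAG §5/§6): the SCALE-LOCAL PAIRING of credits and
windows behind the survival rate of `t4/T4-EST-U5c.md` v1.5.1 §9 — kernel half

WHAT THIS IS NOT (T4-DAG PAGE 1): rung (B)+1 scoping only — existence and uniqueness of the ε → 0 limit of unit-scale
block-averaged expectations on a FIXED finite torus; NOT infinite volume, NOT mass gap, NOT Clay, NOT a proof of NE7b.
Value = kernel bookkeeping for a located cell reading (GAPS C-pv14-43, DIVERGENCE D-pv14.14), NOT summit progress.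

THE QUESTION (cell records `t4/T4-EST-U5E-rem.md` v1 §0 (c)/(Y1)–(Y2), `t4/T4-REF-U5.md`, `t4/T4-EST-U5c.md` §9).
The large-field budget of node U5c prices a structure pending for `n` steps by `σ^n` with
`σ = exp (−(c_b·p̄₀ − E)/N′)`, "one event per `N′` steps".  By the printed flow inequalities the window `R_s`
(B14 (2.5)) at the ultraviolet end of a long run exceeds `R_K` by an unbounded factor ((2.7)/(2.9) "creep"), so a
FIXED `N′` cannot bound every event-free epoch.  The cell reading of `T4-EST-U5c` §9 is that this does not matter on
the PRICE side, because every printed credit is attached at the SAME step as its window and the RATIO credit/window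
is bounded below along the whole run by a constant depending on the infrared coupling `g_K` only.  This module
kernel-checks exactly that ratio statement from the tree's TYPED printed displays, and the elementary bookkeeping
that turns it into the `σ^{span}` price; it asserts nothing printed and performs no history sum.

PRINTED INPUTS, BY NAME (typed displays already in the tree; nothing re-quoted as authority here):
* `B14.FlowIneq27 g β' β₀ p K` — B14 (2.7) p. 255: `(log g_n⁻²)^p ≤ (1+β₀)(log g_m⁻²)^p` and
  `(log g_m⁻²)^p ≤ (1 + g_n² β′(n−m))^{β₀}(log g_n⁻²)^p` for `m < n ≤ K`; PROVED from (2.6) under explicit smallness by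
  `B14FlowStep.flowIneq27_of_26`.  Only the FIRST member (a LOWER bound on the ultraviolet value `log g_m⁻²`) is used.
* `B14.IsRj L r (g s) (R s)` — B14 (2.5) p. 255: `R_s` = the least power of `L` ≥ `(log g_s⁻²)^r`; consumed through
  `B14FlowStep.isRj_le_mul_logpow : R_s ≤ L·(log g_s⁻²)^r`.
* `p0Profile A₀ p₀ g = A₀ (log g⁻²)^{p₀}` — B14 (2.4)/(1.1), B15 (0.1) p. 175 (`Setup`).

WHAT IS PROVED ([folklore] real arithmetic, zero `sorry`, zero cite):
* §1 `pow_sub_le_of_pow_le` — if `0 < y`, `0 ≤ x`, `r ≤ p`, `x^p ≤ (1+β₀)·y^p`, `0 ≤ β₀` then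
  `x^(p−r) ≤ (1+β₀)·y^(p−r)` (case split `y ≤ x` / `x ≤ y`; no roots).
* §2 `kappa A₀ L β₀ p₀ r xK := A₀·xK^(p₀−r)/(L·(1+β₀))` and the RATIO THEOREM `kappa_mul_R_le_p0Profile`:
  under `B14.FlowIneq27 g β' β₀ p₀ K`, `∀ s ≤ K, B14.IsRj L r (g s) (R s)`, `r ≤ p₀`, `1 ≤ L`, `0 ≤ β₀`, `0 ≤ A₀` and
  `1 ≤ log g_s⁻²` along the run:  `∀ s ≤ K, kappa … (log g_K⁻²) · R s ≤ p0Profile A₀ p₀ (g s)` — the constant depends on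
  `g_K` (the infrared = renormalised coupling, the fixed datum of both runs) and NOT on `s` or `K`.
* §3 ABSTRACT EPOCH BOOKKEEPING over a `Finset`: lengths `ℓ e ≤ R e + f e`, credits `κ·R e ≤ c e` ⇒
  `κ·(Σ ℓ − Σ f) ≤ Σ c` (`sum_credit_ge`), and the price form `exp (−Σ c) ≤ exp (−κ·Σ ℓ)·exp (κ·Σ f)`
  (`exp_neg_sum_credit_le`) = "`σ^{span}` up to slack" with `σ := exp (−κ)`.
* §4 K-FREE YOUNG-EPOCH BOUND: if every epoch-start value satisfies `x e ^ p₀ ≤ X ^ p₀` (bank threshold in profile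
  form, `0 ≤ x e`, `0 ≤ X`) then `x e ≤ X` and `Σ_e L·(x e)^r ≤ card·L·X^r` (`sum_window_le_of_pow_le`) — the allowance
  of a bank-young structure's event-started epochs carries no dependence on the length `K` of the run.
* §5 a numerical sanity `example`.

WHAT IS NOT PROVED HERE (and not printed): that print's renewal / merger / birth credits are the ones to pair with
these windows (located READING (P1)/(P2) of `T4-EST-U5c` §9 on B16 pp. 385–387), the banked induction (1.80⁺) (R1),
the relative-weight extraction (R3b), any history/weight sum (NE7b itself).  Cell GAPS.md is the census.
-/

namespace Literature.MathematicalPhysics.QuantumFieldTheory.Balaban1983to89.T4ScalePairing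

open Literature.MathematicalPhysics.QuantumFieldTheory.Balaban1983to89
open Real Finset

/-! ## §1 The exponent-shift lemma (no roots) -/

/-- If `x^p ≤ (1+β₀)·y^p` with `0 < y`, `0 ≤ x`, `0 ≤ β₀` and `r ≤ p`, then `x^(p−r) ≤ (1+β₀)·y^(p−r)`.
Case `x ≤ y`: monotonicity of `t ↦ t^(p−r)` and `1 ≤ 1+β₀`.  Case `y ≤ x`: divide the hypothesis by `y^r ≤ x^r`.
[folklore] -/
theorem pow_sub_le_of_pow_le {x y β₀ : ℝ} {p r : ℕ} (hy : 0 < y) (hx : 0 ≤ x) (hβ : 0 ≤ β₀) (hrp : r ≤ p)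
    (h : x ^ p ≤ (1 + β₀) * y ^ p) : x ^ (p - r) ≤ (1 + β₀) * y ^ (p - r) := by
  rcases le_total x y with hxy | hyx
  · calc x ^ (p - r) ≤ y ^ (p - r) := pow_le_pow_left₀ hx hxy _
      _ = 1 * y ^ (p - r) := (one_mul _).symm
      _ ≤ (1 + β₀) * y ^ (p - r) := by
          apply mul_le_mul_of_nonneg_right (by linarith) (pow_nonneg hy.le _)
  · -- y ≤ x: x^(p-r) * y^r ≤ x^(p-r) * x^r = x^p ≤ (1+β₀) y^p = (1+β₀) y^(p-r) * y^r
    have hyr : 0 < y ^ r := pow_pos hy r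
    have key : x ^ (p - r) * y ^ r ≤ (1 + β₀) * y ^ (p - r) * y ^ r := by
      calc x ^ (p - r) * y ^ r ≤ x ^ (p - r) * x ^ r :=
            mul_le_mul_of_nonneg_left (pow_le_pow_left₀ hy.le hyx r) (pow_nonneg hx _)
        _ = x ^ p := by rw [← pow_add, Nat.sub_add_cancel hrp]
        _ ≤ (1 + β₀) * y ^ p := h
        _ = (1 + β₀) * y ^ (p - r) * y ^ r := by
            rw [mul_assoc, ← pow_add, Nat.sub_add_cancel hrp]
    exact le_of_mul_le_mul_right key hyr

/-! ## §2 The pairing constant and the ratio theorem from (2.5) + (2.7) -/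

/-- The pairing constant `κ(g_K) = A₀ (log g_K⁻²)^{p₀−r} / (L (1+β₀))`: a lower bound for credit/window at every scale
of the run, depending on the infrared coupling only (cell `T4-EST-U5c` §9 (P4)). [folklore] -/
noncomputable def kappa (A₀ : ℝ) (L : ℕ) (β₀ : ℝ) (p₀ r : ℕ) (xK : ℝ) : ℝ :=
  A₀ * xK ^ (p₀ - r) / ((L : ℝ) * (1 + β₀))

/-- `κ ≥ 0` for nonnegative data. [folklore] -/
theorem kappa_nonneg {A₀ β₀ xK : ℝ} {L p₀ r : ℕ} (hA : 0 ≤ A₀) (hβ : 0 ≤ β₀) (hx : 0 ≤ xK) :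
    0 ≤ kappa A₀ L β₀ p₀ r xK := by
  unfold kappa; positivity

/-- RATIO THEOREM (kernel half of `T4-EST-U5c` §9 (P4)).  Along a run `g 0, …, g K` satisfying the typed B14 (2.7)
with exponent `p₀` and with windows `R s` tied to the couplings by the typed (2.5), if `r ≤ p₀` then at EVERY scale
`s ≤ K` the small-field credit profile dominates the window at the infrared rate:
`κ(g_K) · R_s ≤ p₀(g_s) = A₀ (log g_s⁻²)^{p₀}`.  The constant is `s`- and `K`-independent given `g_K`.
Hypothesis `hx1 : 1 ≤ log g_s⁻²` is the (very weak) smallness making `(log g_s⁻²)^r ≥ 1` for (2.5)'s minimality. [folklore] -/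
theorem kappa_mul_R_le_p0Profile {g : ℕ → ℝ} {R : ℕ → ℕ} {β' β₀ A₀ : ℝ} {L p₀ r K : ℕ}
    (h27 : B14.FlowIneq27 g β' β₀ p₀ K) (hR : ∀ s, s ≤ K → B14.IsRj L r (g s) (R s))
    (hrp : r ≤ p₀) (hL : 1 ≤ L) (hβ : 0 ≤ β₀) (hA : 0 ≤ A₀)
    (hx1 : ∀ s, s ≤ K → 1 ≤ Real.log ((g s) ^ 2)⁻¹) :
    ∀ s, s ≤ K → kappa A₀ L β₀ p₀ r (Real.log ((g K) ^ 2)⁻¹) * (R s : ℝ) ≤ p0Profile A₀ p₀ (g s) := by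
  intro s hs
  set xs : ℝ := Real.log ((g s) ^ 2)⁻¹ with hxs
  set xK : ℝ := Real.log ((g K) ^ 2)⁻¹ with hxK
  have hxs1 : 1 ≤ xs := hx1 s hs
  have hxK1 : 1 ≤ xK := hx1 K le_rfl
  have hxs0 : 0 < xs := by linarith
  have hxK0 : 0 ≤ xK := by linarith
  have hL0 : (0 : ℝ) < L := by exact_mod_cast hL
  have h1β : 0 < 1 + β₀ := by linarith
  -- (2.7) first member with m = s < n = K (or s = K trivially): xK^p₀ ≤ (1+β₀) xs^p₀
  have h27' : xK ^ p₀ ≤ (1 + β₀) * xs ^ p₀ := by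
    rcases Nat.lt_or_ge s K with hlt | hge
    · exact (h27 s K hlt le_rfl).1
    · have : s = K := le_antisymm hs hge
      subst this
      calc xs ^ p₀ = 1 * xs ^ p₀ := (one_mul _).symm
        _ ≤ (1 + β₀) * xs ^ p₀ := mul_le_mul_of_nonneg_right (by linarith) (pow_nonneg hxs0.le _)
  -- shift the exponent: xK^(p₀-r) ≤ (1+β₀) xs^(p₀-r)
  have hshift : xK ^ (p₀ - r) ≤ (1 + β₀) * xs ^ (p₀ - r) :=
    pow_sub_le_of_pow_le hxs0 hxK0 hβ hrp h27'
  -- (2.5): R_s ≤ L xs^r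
  have hRs : (R s : ℝ) ≤ L * xs ^ r :=
    B14FlowStep.isRj_le_mul_logpow hL (hR s hs) (one_le_pow₀ hxs1)
  -- assemble
  have hprof : p0Profile A₀ p₀ (g s) = A₀ * xs ^ p₀ := rfl
  rw [hprof]
  unfold kappa
  have hsplit : xs ^ p₀ = xs ^ (p₀ - r) * xs ^ r := by
    rw [← pow_add, Nat.sub_add_cancel hrp]
  calc A₀ * xK ^ (p₀ - r) / ((L : ℝ) * (1 + β₀)) * (R s : ℝ)
      ≤ A₀ * xK ^ (p₀ - r) / ((L : ℝ) * (1 + β₀)) * (L * xs ^ r) := by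
        apply mul_le_mul_of_nonneg_left hRs
        positivity
    _ = (A₀ * xs ^ r) * (xK ^ (p₀ - r) / (1 + β₀)) := by
        field_simp
    _ ≤ (A₀ * xs ^ r) * xs ^ (p₀ - r) := by
        apply mul_le_mul_of_nonneg_left _ (by positivity)
        rw [div_le_iff₀ h1β]
        calc xK ^ (p₀ - r) ≤ (1 + β₀) * xs ^ (p₀ - r) := hshift
          _ = xs ^ (p₀ - r) * (1 + β₀) := mul_comm _ _
    _ = A₀ * xs ^ p₀ := by rw [hsplit]; ring

/-- The infrared member: `p̄₀ := min_s p₀(g_s) ≥ (1+β₀)⁻¹ p₀(g_K)` — every credit along the run is at least the infrared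
one up to `(1+β₀)`, by the first member of (2.7) alone (`T4-EST-U5c` §9 (P4), first clause; precision G-pv06g8-2). [folklore] -/
theorem p0Profile_ge_infrared {g : ℕ → ℝ} {β' β₀ A₀ : ℝ} {p₀ K : ℕ}
    (h27 : B14.FlowIneq27 g β' β₀ p₀ K) (hβ : 0 ≤ β₀) (hA : 0 ≤ A₀)
    (hxK : 0 ≤ Real.log ((g K) ^ 2)⁻¹) :
    ∀ s, s ≤ K → p0Profile A₀ p₀ (g K) ≤ (1 + β₀) * p0Profile A₀ p₀ (g s) := by
  intro s hs
  unfold p0Profile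
  rcases Nat.lt_or_ge s K with hlt | hge
  · have := (h27 s K hlt le_rfl).1
    calc A₀ * Real.log ((g K) ^ 2)⁻¹ ^ p₀ ≤ A₀ * ((1 + β₀) * Real.log ((g s) ^ 2)⁻¹ ^ p₀) :=
          mul_le_mul_of_nonneg_left this hA
      _ = (1 + β₀) * (A₀ * Real.log ((g s) ^ 2)⁻¹ ^ p₀) := by ring
  · have : s = K := le_antisymm hs hge
    subst this
    have h0 : 0 ≤ A₀ * Real.log ((g s) ^ 2)⁻¹ ^ p₀ := mul_nonneg hA (pow_nonneg hxK _)
    calc A₀ * Real.log ((g s) ^ 2)⁻¹ ^ p₀ = 1 * (A₀ * Real.log ((g s) ^ 2)⁻¹ ^ p₀) := (one_mul _).symm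
      _ ≤ (1 + β₀) * (A₀ * Real.log ((g s) ^ 2)⁻¹ ^ p₀) :=
          mul_le_mul_of_nonneg_right (by linarith) h0

/-! ## §3 Abstract epoch bookkeeping: credits ≥ κ·(span − slack), and the `σ^{span}` price -/

/-- PAIRING LEMMA, abstract form.  For a finite family of epochs with lengths `ℓ e ≤ R e + f e` (window + fatness/O(1)
slack) and credits `κ·R e ≤ c e` attached at the SAME epoch, the total credit is at least `κ·(Σ ℓ − Σ f)`
(`T4-EST-U5c` §9 PAIRING LEMMA; the identification of `c`, `R`, `f` with print's renewal/merger/birth credits and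
windows is the located READING (P1)/(P2), not proved here). [folklore] -/
theorem sum_credit_ge {ι : Type*} (s : Finset ι) {ℓ R f c : ι → ℝ} {κ : ℝ} (hκ : 0 ≤ κ)
    (hlen : ∀ e ∈ s, ℓ e ≤ R e + f e) (hcred : ∀ e ∈ s, κ * R e ≤ c e) :
    κ * (∑ e ∈ s, ℓ e - ∑ e ∈ s, f e) ≤ ∑ e ∈ s, c e := by
  have h1 : ∑ e ∈ s, ℓ e - ∑ e ∈ s, f e ≤ ∑ e ∈ s, R e := by
    rw [sub_le_iff_le_add, ← Finset.sum_add_distrib]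
    exact Finset.sum_le_sum hlen
  calc κ * (∑ e ∈ s, ℓ e - ∑ e ∈ s, f e) ≤ κ * ∑ e ∈ s, R e := mul_le_mul_of_nonneg_left h1 hκ
    _ = ∑ e ∈ s, κ * R e := Finset.mul_sum _ _ _
    _ ≤ ∑ e ∈ s, c e := Finset.sum_le_sum hcred

/-- The PRICE form: with `σ := exp (−κ)`, `exp (−Σ c) ≤ σ^{span} · exp (κ·slack)` where `span = Σ ℓ`, `slack = Σ f`
— the step-count shorthand `σ_age^{span}` of `T4-EST-U5c` (d)/(R5) and `T4-EST-U5Ea2` §8.5, K-uniform because `κ`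
is (`kappa_mul_R_le_p0Profile`). [folklore] -/
theorem exp_neg_sum_credit_le {ι : Type*} (s : Finset ι) {ℓ R f c : ι → ℝ} {κ : ℝ} (hκ : 0 ≤ κ)
    (hlen : ∀ e ∈ s, ℓ e ≤ R e + f e) (hcred : ∀ e ∈ s, κ * R e ≤ c e) :
    Real.exp (-(∑ e ∈ s, c e)) ≤ Real.exp (-κ) ^ (∑ e ∈ s, ℓ e) * Real.exp (κ * ∑ e ∈ s, f e) := by
  have h := sum_credit_ge s hκ hlen hcred
  rw [← Real.exp_mul, ← Real.exp_add]
  apply Real.exp_le_exp.mpr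
  nlinarith [h]

/-- Natural-number span version of the price form (lengths counted in steps): if `κ·(n − F) ≤ B` for the total credit
`B`, span `n : ℕ` and slack `F`, then `exp (−B) ≤ σ^n · exp (κ F)` with `σ = exp (−κ)`. [folklore] -/
theorem exp_neg_le_sigma_pow {κ B F : ℝ} {n : ℕ} (h : κ * ((n : ℝ) - F) ≤ B) :
    Real.exp (-B) ≤ Real.exp (-κ) ^ n * Real.exp (κ * F) := by
  rw [← Real.exp_nat_mul, ← Real.exp_add]
  apply Real.exp_le_exp.mpr
  nlinarith [h]

/-! ## §4 The K-free bound on a bank-young structure's event-started epochs -/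

/-- From a profile-form bank threshold `x^p₀ ≤ X^p₀` (`0 ≤ X`, `0 < p₀`) to `x ≤ X`. [folklore] -/
theorem le_of_pow_le_pow {x X : ℝ} {p₀ : ℕ} (hX : 0 ≤ X) (hp : p₀ ≠ 0) (h : x ^ p₀ ≤ X ^ p₀) :
    x ≤ X :=
  le_of_pow_le_pow_left₀ hp hX h

/-- YOUNG-EPOCH ALLOWANCE, K-free (`T4-EST-U5c` §9 (iv)/(vii)): if every event-started epoch `e` of a bank-young
structure has start value `x e` with `(x e)^p₀ ≤ X^p₀` — `X` the profile point of the bank threshold, a function of the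
threshold and of `g_K` only — then the summed windows obey `Σ_e L·(x e)^r ≤ card · L · X^r`: no dependence on the
length `K` of the run enters. [folklore] -/
theorem sum_window_le_of_pow_le {ι : Type*} (s : Finset ι) {x : ι → ℝ} {X : ℝ} {L p₀ r : ℕ}
    (hx : ∀ e ∈ s, 0 ≤ x e) (hX : 0 ≤ X) (hp : p₀ ≠ 0) (h : ∀ e ∈ s, x e ^ p₀ ≤ X ^ p₀) :
    ∑ e ∈ s, (L : ℝ) * x e ^ r ≤ s.card * ((L : ℝ) * X ^ r) := by
  have hle : ∀ e ∈ s, (L : ℝ) * x e ^ r ≤ (L : ℝ) * X ^ r := by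
    intro e he
    have hxe : x e ≤ X := le_of_pow_le_pow hX hp (h e he)
    exact mul_le_mul_of_nonneg_left (pow_le_pow_left₀ (hx e he) hxe r) (Nat.cast_nonneg L)
  calc ∑ e ∈ s, (L : ℝ) * x e ^ r ≤ ∑ e ∈ s, (L : ℝ) * X ^ r := Finset.sum_le_sum hle
    _ = s.card * ((L : ℝ) * X ^ r) := by rw [Finset.sum_const, nsmul_eq_mul]

/-- Combined K-free lifetime bound for the event-started epochs: lengths `ℓ e ≤ L·(x e)^r + f e` and the profile
threshold give `Σ ℓ ≤ card·L·X^r + Σ f`. [folklore] -/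
theorem sum_length_le_of_young {ι : Type*} (s : Finset ι) {x ℓ f : ι → ℝ} {X : ℝ} {L p₀ r : ℕ}
    (hx : ∀ e ∈ s, 0 ≤ x e) (hX : 0 ≤ X) (hp : p₀ ≠ 0) (h : ∀ e ∈ s, x e ^ p₀ ≤ X ^ p₀)
    (hlen : ∀ e ∈ s, ℓ e ≤ (L : ℝ) * x e ^ r + f e) :
    ∑ e ∈ s, ℓ e ≤ s.card * ((L : ℝ) * X ^ r) + ∑ e ∈ s, f e := by
  calc ∑ e ∈ s, ℓ e ≤ ∑ e ∈ s, ((L : ℝ) * x e ^ r + f e) := Finset.sum_le_sum hlen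
    _ = ∑ e ∈ s, (L : ℝ) * x e ^ r + ∑ e ∈ s, f e := Finset.sum_add_distrib
    _ ≤ s.card * ((L : ℝ) * X ^ r) + ∑ e ∈ s, f e := by
        have := sum_window_le_of_pow_le s (L := L) (r := r) hx hX hp h
        linarith

/-! ## §5 Sanity -/

/-- Numerical sanity of `kappa`: with `A₀ = 1`, `L = 2`, `β₀ = 0`, `p₀ = 3`, `r = 1`, `x_K = 2` one gets `κ = 2`. -/
example : kappa 1 2 0 3 1 2 = 2 := by
  unfold kappa; norm_num

/-- Sanity of the price form on a one-epoch family. -/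
example : Real.exp (-(3 : ℝ)) ≤ Real.exp (-1) ^ (2 : ℕ) * Real.exp (1 * 1) := by
  have h : (1 : ℝ) * (((2 : ℕ) : ℝ) - 1) ≤ 3 := by norm_num
  exact exp_neg_le_sigma_pow h

end Literature.MathematicalPhysics.QuantumFieldTheory.Balaban1983to89.T4ScalePairing
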